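import Summits.ResolutionOfSingularities.ResolutionOfSingularities.Theorems.FrobeniusLadderFInjectiveMacaulayficationTauFloorInputNotFull
import Summits.ResolutionOfSingularities.ResolutionOfSingularities.Theorems.FrobeniusLadderFInjectiveMacaulayficationStalkChartIsoPoint
import HarnessLib

/-!
# The F-half's input binders for a local blowing up, from CHART FACTS OVER THE CLOSED POINT ONLY
# (crux `FInjectiveMacaulayfication` stmt-ResolutionOfSingularities-15315, chain w45a; res-L1-w45a-plan-1 R18.27 (N1) piece (A); seat res-L1-w45a-stub-1 g10)

[OURS · L1 W4.5a] Support file (`--supports stmt-ResolutionOfSingularities-15315 --as helper`); replaces the role of NO printed item; NOT a statement of any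
manuscript; def-free; UNCONDITIONAL; generic (no specimen). AI-written (AI review is weaker than expert review).

WHAT. Upgrades of the generic §1/§3 of `TauFloorInputLegal` (p624171) needed by every τ-floor whose Rees charts do NOT all carry points over the vertex (P2d4F5: the
chart `D(z)` has none, idea-1 `tau-P2d4F5-floor1.json`): for a global blowing up `π_B : B → X` along `J` with `Supp J ∋ y ⤳ x ⇒ y = x` and `X` regular at the proper
generizations of `x`,
* §1 `mem_regularLocus_of_specializes_of_ne` — `B` is regular at every point over a PROPER generization of `x` (`π_B` is a local isomorphism off `Supp J`, Stacks 02OS);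
  `cmCl_of_specializes` — hence the CM clause at every point of `B` over a generization of `x` follows from the CM clause at the points OVER `x` alone;
  ★ `offFibre_regular_and_cmCl_over` — the two `S′`-side binders «regular off the closed fibre» and «CM everywhere» for EVERY blowing up `g : S′ → Spec 𝒪_{X,x}` along
  `J|_{Spec 𝒪_{X,x}}`, from `hcm : ∀ b, π_B b = x → CMCl 𝒪_{B,b}` only (p624171's `offFibre_regular_and_cmCl` wanted all `b`).
* §2 (affine, `B = Bl_I(Spec R)`, `I = (x₁,…,x_r)`) ★ `cmCl_stalk_affineBlowup_of_charts_over` — CM at the stalks over `v ∈ Spec R` from CM of the Rees charts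
  `(R[It])_{(xᵢt)}` at the primes CONTRACTING TO `v` (`StalkChartIsoPoint` + `affineBlowup.π_awayι_reesT_apply`, GW (13.19)); `not_comap_eq_of_map_eq_top` — a chart
  whose blow-up algebra `R[I/xᵢ]` satisfies `v·R[I/xᵢ] = (1)` has NO prime over `v` (so contributes nothing), via `ReesChartFacts.exists_reesChartEquiv`.
[folklore assembly; cite: StacksProject, Tag 02OS; Tag 0804] [cite: GortzWedhorn2020, Prop. 13.91 (2), (13.19)] [cite: Temkin2008, §2.1]
-/

-- single-problem summit: the doubled namespace component is forced
set_option linter.dupNamespace false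

noncomputable section

namespace Summit.ResolutionOfSingularities.ResolutionOfSingularities.Theorems.FInjectiveMacaulayfication.LocalBlowupInputFromCharts

open CategoryTheory CategoryTheory.Limits AlgebraicGeometry TopologicalSpace IsLocalRing
open Literature.AlgebraicGeometry.Resolution
open Summit.ResolutionOfSingularities.ResolutionOfSingularities.Theorems.FInjectiveMacaulayfication
open SliceableCentre GermOfGlobalBlowup

/-! ## §1 Points of `B` over proper generizations of `x` are regular -/

/-- **`B` is regular over the proper generizations of `x`**: there `π_B` is a local isomorphism (off `Supp J`, Stacks 02OS) onto regular points of `X`.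
[folklore; cite: StacksProject, Tag 02OS] -/
theorem mem_regularLocus_of_specializes_of_ne {X B : Scheme.{0}} (x : X) {πB : B ⟶ X} {J : X.IdealSheafData} (hB : IsBlowup πB J)
    (hsupp : ∀ y ∈ (J.support : Set X), y ⤳ x → y = x)
    (hreg : ∀ y : X, y ⤳ x → y ≠ x → y ∈ Scheme.regularLocus X)
    (b : B) (hbx : πB.base b ⤳ x) (hne : πB.base b ≠ x) : b ∈ Scheme.regularLocus B := by
  have hU : πB.base b ∈ (⟨(J.support : Set X)ᶜ, J.support.isClosed.isOpen_compl⟩ : X.Opens) := fun hmem => hne (hsupp _ hmem hbx)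
  haveI := hB.isIso_compl
  exact (mem_regularLocus_iff_of_isIso_morphismRestrict πB _ _ hU).mpr (hreg _ hbx hne)

/-- **The CM clause over all generizations of `x` from the CM clause over `x`** (regular local rings are CM, `cmClause_of_isRegularLocalRing`).
[folklore; cite: BrunsHerzog1993, Cor. 2.2.6] -/
theorem cmCl_of_specializes {X B : Scheme.{0}} (x : X) {πB : B ⟶ X} {J : X.IdealSheafData} (hB : IsBlowup πB J)
    (hsupp : ∀ y ∈ (J.support : Set X), y ⤳ x → y = x)
    (hreg : ∀ y : X, y ⤳ x → y ≠ x → y ∈ Scheme.regularLocus X)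
    (hcm : ∀ b : B, πB.base b = x → CMCl (B.presheaf.stalk b))
    (b : B) (hbx : πB.base b ⤳ x) : CMCl (B.presheaf.stalk b) := by
  by_cases hne : πB.base b = x
  · exact hcm b hne
  · haveI : IsRegularLocalRing (B.presheaf.stalk b) :=
      (Scheme.mem_regularLocus b).mp (mem_regularLocus_of_specializes_of_ne x hB hsupp hreg b hbx hne)
    exact cmClause_of_isRegularLocalRing (B.presheaf.stalk b)

/-- ★ **REGULAR OFF THE CLOSED FIBRE and CM EVERYWHERE for every local blowing up `g : S′ → Spec 𝒪_{X,x}` along `J|_{Spec 𝒪_{X,x}}`, from chart facts OVER `x` ONLY.**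
As p624171's `offFibre_regular_and_cmCl`, with `hcm` weakened to the points of `B` over `x`. [folklore assembly; cite: GortzWedhorn2020, Prop. 13.91 (2)]
[cite: StacksProject, Tag 02OS] [cite: Temkin2008, §2.1] -/
theorem offFibre_regular_and_cmCl_over {X B : Scheme.{0}} (x : X) {πB : B ⟶ X} {J : X.IdealSheafData} (hB : IsBlowup πB J)
    (hsupp : ∀ y ∈ (J.support : Set X), y ⤳ x → y = x)
    (hreg : ∀ y : X, y ⤳ x → y ≠ x → y ∈ Scheme.regularLocus X)
    (hcm : ∀ b : B, πB.base b = x → CMCl (B.presheaf.stalk b))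
    {S' : Scheme.{0}} {g : S' ⟶ Spec (X.presheaf.stalk x)} (hg : IsBlowup g (J.comap (X.fromSpecStalk x))) :
    (∀ s : S', g.base s ≠ closedPoint (X.presheaf.stalk x) → s ∈ Scheme.regularLocus S') ∧ (∀ s : S', CMCl (S'.presheaf.stalk s)) := by
  haveI : Flat (X.fromSpecStalk x) := flat_fromSpecStalk X x
  have hP := hB.pullback_snd_of_flat (X.fromSpecStalk x)
  obtain ⟨e, he, -⟩ := hg.unique hP
  -- stalks of `S′` are stalks of `B`, at points over generizations of `x`
  have hstalk : ∀ s : S', Nonempty (B.presheaf.stalk ((pullback.fst πB (X.fromSpecStalk x)).base (e.hom.base s)) ≃+* S'.presheaf.stalk s) := by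
    intro s
    haveI := isIso_stalkMap_of_flat_of_isPreimmersion e.hom s
    haveI := isIso_stalkMap_pullback_fst_fromSpecStalk πB x (e.hom.base s)
    exact ⟨(asIso ((pullback.fst πB (X.fromSpecStalk x)).stalkMap (e.hom.base s))).commRingCatIsoToRingEquiv.trans
      (asIso (e.hom.stalkMap s)).commRingCatIsoToRingEquiv⟩
  have hgs : ∀ s : S', g.base s = (pullback.snd πB (X.fromSpecStalk x)).base (e.hom.base s) := fun s => by
    rw [← he]; rfl
  have hcond : ∀ s : S', πB.base ((pullback.fst πB (X.fromSpecStalk x)).base (e.hom.base s)) =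
      (X.fromSpecStalk x).base ((pullback.snd πB (X.fromSpecStalk x)).base (e.hom.base s)) := fun s =>
    congrArg (fun φ => φ.base (e.hom.base s)) (pullback.condition (f := πB) (g := X.fromSpecStalk x))
  have hspec : ∀ s : S', πB.base ((pullback.fst πB (X.fromSpecStalk x)).base (e.hom.base s)) ⤳ x := fun s => by
    rw [hcond]; exact fromSpecStalk_specializes x _
  refine ⟨fun s hs => ?_, fun s => ?_⟩
  · have hne : πB.base ((pullback.fst πB (X.fromSpecStalk x)).base (e.hom.base s)) ≠ x := by
      intro h
      rw [hcond] at h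
      exact hs ((hgs s).trans (eq_closedPoint_of_fromSpecStalk_eq x _ h))
    have hb := mem_regularLocus_of_specializes_of_ne x hB hsupp hreg _ (hspec s) hne
    rw [Scheme.mem_regularLocus] at hb ⊢
    obtain ⟨es⟩ := hstalk s
    exact IsRegularLocalRing.of_ringEquiv es
  · obtain ⟨es⟩ := hstalk s
    exact FiLocusOpenOfAffine.cmClause_of_ringEquiv es (cmCl_of_specializes x hB hsupp hreg hcm _ (hspec s))

/-! ## §2 Affine: CM over `v` from the Rees charts' primes over `v` -/

/-- ★ **CM at the stalks of `Bl_I(Spec R)` over `v`, from CM of the Rees charts at the primes contracting to `v`.** Every point `y` is `awayι q` for a prime `q` of the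
chart ring `(R[It])_{(xᵢt)}` of a non-zero generator, with `𝒪_{Bl,y} ≅` its local ring (`StalkChartIsoPoint`) and `π y = q ∩ R` (GW (13.19)).
[folklore; cite: StacksProject, Tag 0804] [cite: GortzWedhorn2020, (13.19)] -/
theorem cmCl_stalk_affineBlowup_of_charts_over {R : Type} [CommRing R] {r : ℕ} (x : Fin r → R) (v : Spec (.of R))
    (hCM : ∀ i : Fin r, x i ≠ 0 → ∀ (q : PrimeSpectrum (HomogeneousLocalization.Away (reesGrading (Ideal.span (Set.range x)))
      (reesT (x i) (Ideal.subset_span (Set.mem_range_self i))))),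
      PrimeSpectrum.comap (reesChartBase (x i) (Ideal.subset_span (Set.mem_range_self i))) q = v → CMCl (Localization.AtPrime q.asIdeal))
    (y : ↥(affineBlowup (Ideal.span (Set.range x)))) (hy : (affineBlowup.π (Ideal.span (Set.range x))).base y = v) :
    CMCl ((affineBlowup (Ideal.span (Set.range x))).presheaf.stalk y) := by
  obtain ⟨i, q, hxi, hq, ⟨e⟩⟩ := StalkChartIsoPoint.stub_stalkChartIsoPoint R r x y
  refine FiLocusOpenOfAffine.cmClause_of_ringEquiv e.symm (hCM i hxi q ?_)
  rw [← affineBlowup.π_awayι_reesT_apply (I := Ideal.span (Set.range x)) (x i) (Ideal.subset_span (Set.mem_range_self i)) q]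
  change (affineBlowup.π (Ideal.span (Set.range x))).base ((Proj.awayι _ _ _ _).base q) = v
  rw [hq, hy]

/-- Transport form (type variables, to keep the Rees chart ring's instance paths out of unification): along `e : T ≅ B₁` over `R`, if `v·B₁ = (1)` then no prime of `T`
contracts to `v`. [plumbing] -/
theorem not_comap_eq_of_map_eq_top_aux {R T B₁ : Type} [CommRing R] [CommRing T] [CommRing B₁] (φ : R →+* T) (ψ : R →+* B₁) (e : T ≃+* B₁)
    (he : ∀ r : R, e (φ r) = ψ r) (v : Spec (.of R)) (htop : v.asIdeal.map ψ = ⊤) (q : PrimeSpectrum T) : PrimeSpectrum.comap φ q ≠ v := by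
  intro hqv
  have hle : v.asIdeal.map ψ ≤ q.asIdeal.map e.toRingHom := by
    rw [Ideal.map_le_iff_le_comap]
    intro r hr
    have hr' : r ∈ (PrimeSpectrum.comap φ q).asIdeal := by rw [hqv]; exact hr
    rw [PrimeSpectrum.comap_asIdeal, Ideal.mem_comap] at hr'
    rw [Ideal.mem_comap, ← he]
    exact Ideal.mem_map_of_mem _ hr'
  have hne : q.asIdeal.map e.toRingHom ≠ ⊤ := fun htop' => q.2.ne_top (by
    have h : (q.asIdeal.map e.toRingHom).comap e.toRingHom = (⊤ : Ideal B₁).comap e.toRingHom := by rw [htop']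
    rwa [Ideal.comap_map_of_bijective e.toRingHom e.bijective, Ideal.comap_top] at h)
  exact hne (top_le_iff.mp (htop ▸ hle))

/-- **A chart without points over `v`**: if `v·R[I/a] = (1)` then no prime of the Rees chart `(R[It])_{(at)}` contracts to `v` (so such charts contribute no condition to
`cmCl_stalk_affineBlowup_of_charts_over`). [folklore; cite: GortzWedhorn2020, (13.19)] -/
theorem not_comap_eq_of_map_eq_top {R : Type} [CommRing R] (I : Ideal R) (a : R) (ha : a ∈ I) (v : Spec (.of R))
    (htop : v.asIdeal.map (algebraMap R (blowupAlgebra I a)) = ⊤)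
    (q : PrimeSpectrum (HomogeneousLocalization.Away (reesGrading I) (reesT a ha))) :
    PrimeSpectrum.comap (reesChartBase a ha) q ≠ v := by
  obtain ⟨e, he⟩ := ReesChartFacts.exists_reesChartEquiv I a ha
  exact not_comap_eq_of_map_eq_top_aux (T := HomogeneousLocalization.Away (reesGrading I) (reesT a ha)) _ _ e he v htop q

end Summit.ResolutionOfSingularities.ResolutionOfSingularities.Theorems.FInjectiveMacaulayfication.LocalBlowupInputFromCharts

end
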